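import Mathlib
import HarnessLib
import Summits.HubbardSuperconductivity.HubbardSuperconductivity.Theorems.KLProgrammeKLRegimeCountertermJacksonRemainderLocal

/-!
# Route `KLProgramme`, crux K3 — engine-flow child (stmt-HubbardSuperconductivity-20437), stub (C) `stub_twoLeg_curvature`, (C1) door, FAR part:
# A SHARPER CUBIC TAIL OF THE JACKSON KERNEL — `∫_δ^π J̃_d ≤ (4/π)(24/23)⁴/((d+1)δ)³ + π³/(4(d+1)³)` (`0 < δ ≤ 1`)

Cell gate-hubbard-kl, seat hubbard-kl-k3c3-p3 (g6).  The far («cutoff-shell») part of the (C1) Jackson remainder is `(far mass) × (sizes on the shell)`;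
the far mass of record is k3c3-p1's `integral_jker_tail_le` / `integral_jweight_mul_jfar_le` (`π³/((d+1)δ)³` on the smoothing square), which rests on
Jordan's `sin(πx) ≥ 2x` and is ≈ 10× the measured mass (memo JACKSON-FLAT §2: 0.37 % measured vs 3.9 % proved at `d = 2⁹`).  Replacing Jordan by
`sin y ≥ y − y³/6` (`Real.sin_ge_sub_cube`) on `s ≤ 1` gains the factor `π⁴(23/24)⁴/16 ≈ 5.1`:
* §1 `fejer_le_inv_cube`, `jackson_le_inv_cube` (period-1 variable), `jker_le_inv_pow_four_sharp` (`J̃_d(s) ≤ (12/π)(24/23)⁴/((d+1)³s⁴)` on `0 < s ≤ 1`);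
* §2 **`integral_jker_tail_le_sharp`**: `∫_δ^π J̃_d ≤ (4/π)(24/23)⁴/((d+1)δ)³ + π³/(4(d+1)³)` for `0 < δ ≤ 1` (`≈ 1.51/((d+1)δ)³`; the second term is the
  old bound on `[1, π]`, relatively `O(δ³)`);
* §3 the far-mass forms consumed by the (C1) door: `integral_jker_mul_jfar_le_sharp` (both 1-D tails) and **`integral_jweight_mul_jfar_le_sharp`**
  (`∫ J̃J̃·(𝟙_{|s|>δ} + 𝟙_{|t|>δ}) dμ ≤ (16/π)(24/23)⁴/((d+1)δ)³ + π³/(d+1)³`, i.e. `≈ 6.04/((d+1)δ)³` against `31/((d+1)δ)³`).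
Pure real analysis; nothing about the model.  DeVore–Lorentz, Constructive Approximation, Ch. 7 §2 [cite: BenfattoGiulianiMastropietro2006, §2.2 for the role].
-/

noncomputable section

namespace Summit.HubbardSuperconductivity.HubbardSuperconductivity.Theorems.KLRegimeSplit

set_option linter.dupNamespace false -- summit = problem name (single-conjunct summit), D-0017

open Real MeasureTheory Filter intervalIntegral
open Literature.Analysis.Fourier.TrigApprox

/-! ## §1 Pointwise bounds from `sin y ≥ y − y³/6` -/

/-- On `0 < x ≤ 1/2`: `0 < πx − (πx)³/6` (indeed `(πx)² ≤ π²/4 < 6`). -/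
theorem sub_cube_pos {x : ℝ} (hx0 : 0 < x) (hx : x ≤ 1 / 2) : 0 < π * x - (π * x) ^ 3 / 6 := by
  have hπ := Real.pi_lt_d2
  have hπ0 := Real.pi_pos
  have hy0 : 0 < π * x := by positivity
  have hy : π * x ≤ 1.575 := by nlinarith
  have hy2 : (π * x) ^ 2 < 6 := by nlinarith
  have : π * x - (π * x) ^ 3 / 6 = (π * x) * (1 - (π * x) ^ 2 / 6) := by ring
  rw [this]; exact mul_pos hy0 (by nlinarith)

/-- **Fejér tail, cubic-corrected**: `F_M(x) ≤ 1/((M+1)(πx − (πx)³/6)²)` on `0 < x ≤ 1/2`. -/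
theorem fejer_le_inv_cube (M : ℕ) {x : ℝ} (hx0 : 0 < x) (hx : x ≤ 1 / 2) :
    fejer M x ≤ 1 / ((M + 1) * (π * x - (π * x) ^ 3 / 6) ^ 2) := by
  have hM : (0 : ℝ) < M + 1 := by positivity
  have hL := sub_cube_pos hx0 hx
  have hsin : (π * x - (π * x) ^ 3 / 6) ^ 2 ≤ Real.sin (π * x) ^ 2 :=
    pow_le_pow_left₀ hL.le (Real.sin_ge_sub_cube (by positivity)) 2
  have hfs := fejer_mul_sin_sq M x
  have hle1 : Real.sin (π * (M + 1) * x) ^ 2 ≤ 1 := Real.sin_sq_le_one _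
  have hf0 := fejer_nonneg M x
  rw [le_div_iff₀ (by positivity)]
  calc fejer M x * ((M + 1) * (π * x - (π * x) ^ 3 / 6) ^ 2) = fejer M x * (M + 1) * (π * x - (π * x) ^ 3 / 6) ^ 2 := by ring
    _ ≤ fejer M x * (M + 1) * Real.sin (π * x) ^ 2 := mul_le_mul_of_nonneg_left hsin (by positivity)
    _ = Real.sin (π * (M + 1) * x) ^ 2 := hfs
    _ ≤ 1 := hle1

/-- **Jackson tail, cubic-corrected**: `J_M(x) ≤ 3/(2(M+1)³(πx − (πx)³/6)⁴)` on `0 < x ≤ 1/2` (with the sharp normaliser `c_M ≥ 2(M+1)/3`). -/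
theorem jackson_le_inv_cube (M : ℕ) {x : ℝ} (hx0 : 0 < x) (hx : x ≤ 1 / 2) :
    jackson M x ≤ 3 / (2 * (M + 1) ^ 3 * (π * x - (π * x) ^ 3 / 6) ^ 4) := by
  have hM : (0 : ℝ) < M + 1 := by positivity
  have hc := jacksonConst_ge_sharp M
  have hc0 := jacksonConst_pos M
  have hL := sub_cube_pos hx0 hx
  have hF := fejer_le_inv_cube M hx0 hx
  have hF0 := fejer_nonneg M x
  unfold jackson
  have h1 : fejer M x ^ 2 ≤ (1 / ((M + 1) * (π * x - (π * x) ^ 3 / 6) ^ 2)) ^ 2 := pow_le_pow_left₀ hF0 hF 2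
  calc fejer M x ^ 2 / jacksonConst M ≤ (1 / ((M + 1) * (π * x - (π * x) ^ 3 / 6) ^ 2)) ^ 2 / (2 * (M + 1) / 3) := by gcongr
    _ = 3 / (2 * (M + 1) ^ 3 * (π * x - (π * x) ^ 3 / 6) ^ 4) := by field_simp

/-- **The `2π`-periodic kernel on `0 < s ≤ 1`**: `J̃_d(s) ≤ (12/π)(24/23)⁴/(d+1)³ · s⁻⁴` (here `(s/2)² ≤ 1/4`, so `1 − (s/2)²/6 ≥ 23/24`). -/
theorem jker_le_inv_pow_four_sharp (d : ℕ) {s : ℝ} (hs0 : 0 < s) (hs1 : s ≤ 1) :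
    jker d s ≤ 12 / π * (24 / 23) ^ 4 / (d + 1) ^ 3 * s ^ (-4 : ℤ) := by
  have hπ0 := Real.pi_pos
  have hπ3 := Real.pi_gt_three
  have hd : (0 : ℝ) < d + 1 := by positivity
  have h2π : (0 : ℝ) < 2 * π := by positivity
  have hx0 : 0 < s / (2 * π) := by positivity
  have hx : s / (2 * π) ≤ 1 / 2 := by rw [div_le_iff₀ h2π]; nlinarith
  have hJ := jackson_le_inv_cube d hx0 hx
  have hy : π * (s / (2 * π)) = s / 2 := by field_simp
  rw [hy] at hJ
  -- the cubic-corrected denominator against `(23/48)·s`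
  have hL0 : 23 / 48 * s ≤ s / 2 - (s / 2) ^ 3 / 6 := by
    have hs2 : s ^ 2 ≤ 1 := by nlinarith
    have e : s / 2 - (s / 2) ^ 3 / 6 - 23 / 48 * s = s * (1 - s ^ 2) / 48 := by ring
    have : 0 ≤ s * (1 - s ^ 2) / 48 := by have := mul_nonneg hs0.le (sub_nonneg.2 hs2); positivity
    linarith
  have hL4 : (23 / 48 * s) ^ 4 ≤ (s / 2 - (s / 2) ^ 3 / 6) ^ 4 := pow_le_pow_left₀ (by positivity) hL0 4
  have hs4 : 0 < (23 / 48 * s) ^ 4 := by positivity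
  unfold jker
  rw [div_le_iff₀ h2π, zpow_neg, zpow_ofNat]
  calc jackson d (s / (2 * π)) ≤ 3 / (2 * (d + 1) ^ 3 * (s / 2 - (s / 2) ^ 3 / 6) ^ 4) := hJ
    _ ≤ 3 / (2 * (d + 1) ^ 3 * (23 / 48 * s) ^ 4) := by gcongr
    _ = 12 / π * (24 / 23) ^ 4 / (d + 1) ^ 3 * (s ^ 4)⁻¹ * (2 * π) := by field_simp; ring

/-! ## §2 The tail -/

/-- **Sharper cubic tail**: `∫_δ^π J̃_d(s) ds ≤ (4/π)(24/23)⁴/((d+1)δ)³ + π³/(4(d+1)³)` for `0 < δ ≤ 1`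
(≈ `1.51/((d+1)δ)³ + 7.75/(d+1)³`, against `integral_jker_tail_le`'s `7.75/((d+1)δ)³`). -/
theorem integral_jker_tail_le_sharp (d : ℕ) {δ : ℝ} (hδ : 0 < δ) (hδ1 : δ ≤ 1) :
    ∫ s in δ..π, jker d s ≤ 4 / π * (24 / 23) ^ 4 / ((d + 1) * δ) ^ 3 + π ^ 3 / (4 * (d + 1) ^ 3) := by
  have hπ3 := Real.pi_gt_three
  have hd : (0 : ℝ) < d + 1 := by positivity
  have h1π : (1 : ℝ) ≤ π := by linarith
  have hI := fun a b : ℝ => (continuous_jker d).intervalIntegrable (μ := volume) a b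
  rw [← intervalIntegral.integral_add_adjacent_intervals (hI δ 1) (hI 1 π)]
  -- `[1, π]`: the old tail bound at `δ = 1`
  have hfar : ∫ s in (1 : ℝ)..π, jker d s ≤ π ^ 3 / (4 * (d + 1) ^ 3) := by
    have h := integral_jker_tail_le d one_pos h1π
    rw [mul_one] at h; exact h
  -- `[δ, 1]`: the cubic-corrected pointwise bound, integrated
  have hnear : ∫ s in δ..(1 : ℝ), jker d s ≤ 4 / π * (24 / 23) ^ 4 / ((d + 1) * δ) ^ 3 := by
    have hmaj : ∫ s in δ..(1 : ℝ), jker d s ≤ ∫ s in δ..(1 : ℝ), 12 / π * (24 / 23) ^ 4 / (d + 1) ^ 3 * s ^ (-4 : ℤ) := by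
      refine intervalIntegral.integral_mono_on hδ1 (hI δ 1) ?_ fun s hs => jker_le_inv_pow_four_sharp d (lt_of_lt_of_le hδ hs.1) hs.2
      refine ContinuousOn.intervalIntegrable ?_
      refine continuousOn_const.mul (ContinuousOn.zpow₀ continuousOn_id _ ?_)
      intro s hs
      rw [Set.uIcc_of_le hδ1] at hs
      left; exact (lt_of_lt_of_le hδ hs.1).ne'
    refine hmaj.trans ?_
    rw [intervalIntegral.integral_const_mul, integral_zpow (Or.inr ⟨by norm_num, ?_⟩)]
    · have e1 : ((-4 : ℤ) + 1) = -3 := by norm_num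
      rw [e1]
      have hδ3 : δ ^ (-3 : ℤ) = 1 / δ ^ 3 := by rw [zpow_neg, zpow_ofNat, one_div]
      have h13 : (1 : ℝ) ^ (-3 : ℤ) = 1 := one_zpow _
      calc 12 / π * (24 / 23 : ℝ) ^ 4 / (d + 1) ^ 3 * (((1 : ℝ) ^ (-3 : ℤ) - δ ^ (-3 : ℤ)) / (((-4 : ℤ) : ℝ) + 1))
          = 4 / π * (24 / 23 : ℝ) ^ 4 / (d + 1) ^ 3 * (δ ^ (-3 : ℤ) - 1) := by rw [h13]; push_cast; ring
        _ ≤ 4 / π * (24 / 23 : ℝ) ^ 4 / (d + 1) ^ 3 * δ ^ (-3 : ℤ) := by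
            apply mul_le_mul_of_nonneg_left _ (by positivity); linarith
        _ = 4 / π * (24 / 23) ^ 4 / ((d + 1) * δ) ^ 3 := by rw [hδ3]; field_simp
    · rw [Set.uIcc_of_le hδ1]
      intro h0; exact absurd h0.1 (not_le.mpr hδ)
  linarith

/-! ## §3 Far-mass forms for the (C1) door (indicator `𝟙_{|s|>δ}` as in `…JacksonRemainderLocal`) -/

/-- **One-dimensional far mass, sharper**: `∫_{−π}^{π} J̃_d·𝟙_{|s|>δ} ≤ (8/π)(24/23)⁴/((d+1)δ)³ + π³/(2(d+1)³)` for `0 < δ ≤ 1`. -/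
theorem integral_jker_mul_jfar_le_sharp (d : ℕ) {δ : ℝ} (hδ : 0 < δ) (hδ1 : δ ≤ 1) :
    ∫ s in (-π)..π, jker d s * Set.indicator {s : ℝ | δ < |s|} (1 : ℝ → ℝ) s ≤
      8 / π * (24 / 23) ^ 4 / ((d + 1) * δ) ^ 3 + π ^ 3 / (2 * (d + 1) ^ 3) := by
  have hπ3 := Real.pi_gt_three
  have hδπ : δ ≤ π := by linarith
  have hI := intervalIntegrable_jker_mul_jfar d δ
  rw [← intervalIntegral.integral_add_adjacent_intervals (hI (-π) (-δ)) (hI (-δ) π),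
    ← intervalIntegral.integral_add_adjacent_intervals (hI (-δ) δ) (hI δ π)]
  -- middle: zero
  have hmid : ∫ s in (-δ)..δ, jker d s * Set.indicator {s : ℝ | δ < |s|} (1 : ℝ → ℝ) s = 0 := by
    rw [intervalIntegral.integral_congr (g := fun _ => (0 : ℝ)) fun s hs => ?_, intervalIntegral.integral_zero]
    rw [Set.uIcc_of_le (by linarith)] at hs
    show jker d s * Set.indicator {s : ℝ | δ < |s|} (1 : ℝ → ℝ) s = 0
    rw [jfar_eq_zero (abs_le.mpr ⟨hs.1, hs.2⟩), mul_zero]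
  -- right: ≤ tail
  have hright : ∫ s in δ..π, jker d s * Set.indicator {s : ℝ | δ < |s|} (1 : ℝ → ℝ) s ≤
      4 / π * (24 / 23) ^ 4 / ((d + 1) * δ) ^ 3 + π ^ 3 / (4 * (d + 1) ^ 3) := by
    refine le_trans ?_ (integral_jker_tail_le_sharp d hδ hδ1)
    refine intervalIntegral.integral_mono_on hδπ (hI δ π) ((continuous_jker d).intervalIntegrable _ _) fun s _ => ?_
    calc jker d s * Set.indicator {s : ℝ | δ < |s|} (1 : ℝ → ℝ) s ≤ jker d s * 1 := mul_le_mul_of_nonneg_left (jfar_le_one δ s) (jker_nonneg d s)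
      _ = jker d s := mul_one _
  -- left: by evenness, equal to the right tail
  have hleft : ∫ s in (-π)..(-δ), jker d s * Set.indicator {s : ℝ | δ < |s|} (1 : ℝ → ℝ) s ≤
      4 / π * (24 / 23) ^ 4 / ((d + 1) * δ) ^ 3 + π ^ 3 / (4 * (d + 1) ^ 3) := by
    have hsym : ∫ s in (-π)..(-δ), jker d s * Set.indicator {s : ℝ | δ < |s|} (1 : ℝ → ℝ) s =
        ∫ s in δ..π, jker d s * Set.indicator {s : ℝ | δ < |s|} (1 : ℝ → ℝ) s := by
      have h := intervalIntegral.integral_comp_neg (a := δ) (b := π) (fun s => jker d s * Set.indicator {s : ℝ | δ < |s|} (1 : ℝ → ℝ) s)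
      rw [← h]
      refine intervalIntegral.integral_congr fun s _ => ?_
      show jker d (-s) * Set.indicator {s : ℝ | δ < |s|} (1 : ℝ → ℝ) (-s) = jker d s * Set.indicator {s : ℝ | δ < |s|} (1 : ℝ → ℝ) s
      rw [jker_neg]; simp only [Set.indicator_apply, Set.mem_setOf_eq, abs_neg, Pi.one_apply]
    rw [hsym]; exact hright
  have hd : (0 : ℝ) < ((d : ℝ) + 1) * δ := by positivity
  have hd1 : (0 : ℝ) < (d : ℝ) + 1 := by positivity
  have e : (4 / π * (24 / 23 : ℝ) ^ 4 / ((d + 1) * δ) ^ 3 + π ^ 3 / (4 * (d + 1) ^ 3)) +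
      (4 / π * (24 / 23 : ℝ) ^ 4 / ((d + 1) * δ) ^ 3 + π ^ 3 / (4 * (d + 1) ^ 3)) =
      8 / π * (24 / 23) ^ 4 / (((d : ℝ) + 1) * δ) ^ 3 + π ^ 3 / (2 * ((d : ℝ) + 1) ^ 3) := by field_simp; ring
  linarith

/-- **Two-dimensional far mass, sharper**: `∫ J̃J̃·(𝟙_{|s|>δ} + 𝟙_{|t|>δ}) dμ ≤ (16/π)(24/23)⁴/((d+1)δ)³ + π³/(d+1)³` for `0 < δ ≤ 1`
(`≈ 6.04/((d+1)δ)³ + 31/(d+1)³`; drop-in for `integral_jweight_mul_jfar_le`'s `π³/((d+1)δ)³ ≈ 31/((d+1)δ)³`). -/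
theorem integral_jweight_mul_jfar_le_sharp (d : ℕ) {δ : ℝ} (hδ : 0 < δ) (hδ1 : δ ≤ 1) :
    ∫ w, jweight d w * (Set.indicator {s : ℝ | δ < |s|} (1 : ℝ → ℝ) w.1 + Set.indicator {s : ℝ | δ < |s|} (1 : ℝ → ℝ) w.2) ∂jmeas ≤
      16 / π * (24 / 23) ^ 4 / ((d + 1) * δ) ^ 3 + π ^ 3 / (d + 1) ^ 3 := by
  have hππ : -π ≤ π := by linarith [Real.pi_pos]
  have h1 := integral_jker_mul_jfar_le_sharp d hδ hδ1
  have e : (fun w : ℝ × ℝ => jweight d w * (Set.indicator {s : ℝ | δ < |s|} (1 : ℝ → ℝ) w.1 + Set.indicator {s : ℝ | δ < |s|} (1 : ℝ → ℝ) w.2)) =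
      fun w => (jker d w.1 * Set.indicator {s : ℝ | δ < |s|} (1 : ℝ → ℝ) w.1) * jker d w.2 +
        jker d w.1 * (jker d w.2 * Set.indicator {s : ℝ | δ < |s|} (1 : ℝ → ℝ) w.2) := by
    funext w; simp only [jweight]; ring
  have i1 : Integrable (fun w : ℝ × ℝ => (jker d w.1 * Set.indicator {s : ℝ | δ < |s|} (1 : ℝ → ℝ) w.1) * jker d w.2) jmeas := by
    have := integrable_jweight_mul_jfar_fst d δ
    refine this.congr (Eventually.of_forall fun w => ?_)
    simp only [jweight]; ring
  have i2 : Integrable (fun w : ℝ × ℝ => jker d w.1 * (jker d w.2 * Set.indicator {s : ℝ | δ < |s|} (1 : ℝ → ℝ) w.2)) jmeas := by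
    have := integrable_jweight_mul_jfar_snd d δ
    refine this.congr (Eventually.of_forall fun w => ?_)
    simp only [jweight]; ring
  rw [e, integral_add i1 i2,
    MeasureTheory.integral_prod_mul (μ := volume.restrict (Set.Ioc (-π) π)) (ν := volume.restrict (Set.Ioc (-π) π))
      (f := fun s => jker d s * Set.indicator {s : ℝ | δ < |s|} (1 : ℝ → ℝ) s) (g := fun t => jker d t),
    MeasureTheory.integral_prod_mul (μ := volume.restrict (Set.Ioc (-π) π)) (ν := volume.restrict (Set.Ioc (-π) π))
      (f := fun s => jker d s) (g := fun t => jker d t * Set.indicator {s : ℝ | δ < |s|} (1 : ℝ → ℝ) t)]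
  simp only [← intervalIntegral.integral_of_le hππ, integral_jker]
  have hd : (0 : ℝ) < ((d : ℝ) + 1) * δ := by positivity
  have hd1 : (0 : ℝ) < (d : ℝ) + 1 := by positivity
  have e2 : (8 / π * (24 / 23 : ℝ) ^ 4 / ((d + 1) * δ) ^ 3 + π ^ 3 / (2 * (d + 1) ^ 3)) +
      (8 / π * (24 / 23 : ℝ) ^ 4 / ((d + 1) * δ) ^ 3 + π ^ 3 / (2 * (d + 1) ^ 3)) =
      16 / π * (24 / 23) ^ 4 / (((d : ℝ) + 1) * δ) ^ 3 + π ^ 3 / ((d : ℝ) + 1) ^ 3 := by field_simp; ring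
  linarith

/-- Numeric reading of the sharper constant: `(16/π)(24/23)⁴ < 6.05` (against `π³ > 31`). -/
theorem sixteen_div_pi_mul_pow_lt : 16 / π * (24 / 23 : ℝ) ^ 4 < 6.05 := by
  have hπ3 := Real.pi_gt_three
  have hπ := Real.pi_gt_d2
  rw [div_mul_eq_mul_div, div_lt_iff₀ Real.pi_pos]
  nlinarith

end Summit.HubbardSuperconductivity.HubbardSuperconductivity.Theorems.KLRegimeSplit

end
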